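import Literature.RingTheory.Flat.IsomorphismModuloNilpotent
import Mathlib.RingTheory.Smooth.Basic
import Mathlib.RingTheory.Smooth.Quotient
import HarnessLib

/-!
# Smooth lifts along a nilpotent thickening of the base are unique up to isomorphism
# ([Oort1971] Lemma (2.2.4) «the lift is unique locally up to a (non-canonical) isomorphism»; [Schlessinger1968] Lemma 3.3)

Topic `Literature/AlgebraicGeometry/Deformation`; namespace `Literature.AlgebraicGeometry.Deformation.StandardSmoothLift`.  PROOF FILE
(theorems only: no definition, no instance, no notation, no named fact, no `sorry`); ring level; any commutative ring `A`, any
nilpotent ideal `J`.  Cell `hodgecm-mathlib` (D-0151), FLOOR 0, P6 «MOD programme», generic organ (R2) of the census for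
`stub_L4B1u_abelianLiftOfIsUnitTwo` ((U), line `Cruxes/HLiu418/Lines/F0_P6b_BTSerreTate.lean` §1): the LOCAL UNIQUENESS of smooth lifts,
companion of (R1) `Deformation/StandardSmoothLiftNilpotent` (local existence).  `--supports stmt-HodgeConjecture-24832`; count-neutral:
HC_CM is proved only modulo the printed citations until rung 0 closes, and nothing here bears on it.

THE PRINT.  [Oort1971] Lemma (2.2.4): «… if moreover `x ∈ U′ ∩ V′`, `V → S` smooth and `V′ = V ⊗_R R′`, then for every affine
neighbourhood `x ∈ W′ ⊂ U′ ∩ V′` there exists an isomorphism `U|W′ ≅ V|W′` … (locally `X′` can be lifted to `R`, and the lift is unique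
locally up to a (non-canonical) isomorphism)», after [SGA1] Exp. III; Oort's Lemma (2.2.2) «flat + isomorphism modulo a nilpotent
ideal ⇒ isomorphism» is [Schlessinger1968] Lemma 3.3 (tree ★ `RingTheory/Flat/IsomorphismModuloNilpotent`).  In ring form:

* **`bijective_of_comp_eq`** — `J ⊆ A` nilpotent; `ρ : B ↠ B₀`, `ρ′ : B′ → B₀` morphisms of `A`-algebras with `ker ρ ⊆ J B`,
  `ker ρ′ ⊆ J B′`, and `B′` FLAT over `A`: every `A`-algebra map `φ : B → B′` over `B₀` (`ρ′ ∘ φ = ρ`) is BIJECTIVE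
  (surjective since `φ(B) + J B′ = B′` and `J` is nilpotent, ★ `Flat.eq_top_of_sup_smul_top_eq_top_of_isNilpotent`; injective since
  `ker φ ⊆ J B ∩ ker φ = J · ker φ` by the flatness of `B′`, Mathlib `LinearMap.ker_inf_smul_top_eq_smul_of_flat`, and ★
  `Flat.eq_bot_of_le_smul_of_isNilpotent`);
* **`exists_algEquiv_of_lifts`** — if moreover `B` is FORMALLY SMOOTH over `A` and `ρ′` is surjective, there IS such a `φ` (Mathlib
  `Algebra.FormallySmooth.liftOfSurjective`, the kernel of `ρ′` being nilpotent), hence an `A`-algebra ISOMORPHISM `B ≃ₐ[A] B′` over `B₀`: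
  two smooth lifts of `B₀` along `A ↠ A ⧸ J` are isomorphic.

## References
* [Oort1971] F. Oort, *Finite group schemes, local moduli for abelian varieties, and lifting problems*, Compositio Math. 23 (1971),
  Lemma (2.2.4) and Lemma (2.2.2) (pp. 273–274).
* [Schlessinger1968] M. Schlessinger, *Functors of Artin rings*, Trans. AMS 130 (1968), Lemma 3.3 (p. 216).
* [SGA1] A. Grothendieck, M. Raynaud, *Revêtements étales et groupe fondamental (SGA 1)*, Exp. III — the source [Oort1971] (2.2.4) cites.
-/

universe u v w

open TensorProduct

namespace Literature.AlgebraicGeometry.Deformation.StandardSmoothLift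

variable {A : Type u} [CommRing A] {J : Ideal A}
  {B : Type v} [CommRing B] [Algebra A B] {B' : Type w} [CommRing B'] [Algebra A B']
  {B₀ : Type*} [CommRing B₀] [Algebra A B₀]

/-- An ideal of an `A`-algebra contained in the extension `J B` of a nilpotent ideal `J ⊆ A` is nilpotent.
[cite: Schlessinger1968, Lemma 3.3, p. 216] -/
theorem isNilpotent_of_le_map (hJ : IsNilpotent J) {I : Ideal B} (hI : I ≤ J.map (algebraMap A B)) :
    IsNilpotent I := by
  obtain ⟨n, hn⟩ := hJ
  refine ⟨n, le_bot_iff.mp ?_⟩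
  calc I ^ n ≤ J.map (algebraMap A B) ^ n := Ideal.pow_right_mono hI n
    _ = ⊥ := by rw [← Ideal.map_pow, hn, Ideal.zero_eq_bot, Ideal.map_bot]

/-- **A morphism between lifts over a nilpotent thickening is bijective as soon as the target is flat** ([Oort1971] (2.2.2) ∕
[Schlessinger1968] Lemma 3.3 in the form the gluing uses): `J ⊆ A` nilpotent, `ρ : B ↠ B₀` and `ρ′ : B′ → B₀` morphisms of `A`-algebras
with `ker ρ ⊆ J B`, `ker ρ′ ⊆ J B′`, `B′` flat over `A`; then every `φ : B →ₐ[A] B′` with `ρ′ ∘ φ = ρ` is bijective.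
[cite: Oort1971, Lemma (2.2.2) and Lemma (2.2.4) (pp. 273–274)] [cite: Schlessinger1968, Lemma 3.3, p. 216] -/
theorem bijective_of_comp_eq [Module.Flat A B'] (hJ : IsNilpotent J)
    (ρ : B →ₐ[A] B₀) (hρ : Function.Surjective ρ) (hkρ : RingHom.ker ρ ≤ J.map (algebraMap A B))
    (ρ' : B' →ₐ[A] B₀) (hkρ' : RingHom.ker ρ' ≤ J.map (algebraMap A B'))
    (φ : B →ₐ[A] B') (hφ : ∀ b, ρ' (φ b) = ρ b) : Function.Bijective φ := by
  -- surjective: `φ(B) + J B' = B'`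
  have hsurj : Function.Surjective φ := by
    have hsup : LinearMap.range φ.toLinearMap ⊔ J • (⊤ : Submodule A B') = ⊤ := by
      refine eq_top_iff.2 fun b' _ => ?_
      obtain ⟨b, hb⟩ := hρ (ρ' b')
      have hmem : b' - φ b ∈ J • (⊤ : Submodule A B') := by
        rw [Ideal.smul_top_eq_map]
        exact hkρ' (by rw [RingHom.mem_ker, map_sub, hφ, hb, sub_self])
      have e : b' = φ b + (b' - φ b) := by abel
      rw [e]
      exact Submodule.add_mem _ (Submodule.mem_sup_left ⟨b, rfl⟩) (Submodule.mem_sup_right hmem)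
    exact LinearMap.range_eq_top.1
      (Literature.RingTheory.Flat.eq_top_of_sup_smul_top_eq_top_of_isNilpotent hJ hsup)
  -- injective: `ker φ ⊆ J B ∩ ker φ = J · ker φ` by flatness of `B'`
  have hinj : Function.Injective φ := by
    rw [← AlgHom.coe_toLinearMap, ← LinearMap.ker_eq_bot]
    refine Literature.RingTheory.Flat.eq_bot_of_le_smul_of_isNilpotent hJ fun x hx => ?_
    have hx0 : φ x = 0 := hx
    have hxJ : x ∈ J • (⊤ : Submodule A B) := by
      rw [Ideal.smul_top_eq_map]
      exact hkρ (by rw [RingHom.mem_ker, ← hφ, hx0, map_zero])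
    rw [← LinearMap.ker_inf_smul_top_eq_smul_of_flat J φ.toLinearMap hsurj]
    exact ⟨hx, hxJ⟩
  exact ⟨hinj, hsurj⟩

/-- **Two smooth lifts along a nilpotent thickening are isomorphic** ([Oort1971] (2.2.4): «the lift is unique locally up to a
(non-canonical) isomorphism»): `J ⊆ A` nilpotent; `B` FORMALLY SMOOTH over `A` with `ρ : B ↠ B₀`, `ker ρ ⊆ J B`; `B′` FLAT over `A`
with `ρ′ : B′ ↠ B₀`, `ker ρ′ ⊆ J B′`.  Then there is an `A`-algebra isomorphism `φ : B ≃ₐ[A] B′` over `B₀` (`ρ′ ∘ φ = ρ`): a lift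
of `ρ` through `ρ′` exists by formal smoothness (Mathlib `Algebra.FormallySmooth.liftOfSurjective`) and is bijective by
`bijective_of_comp_eq`. [cite: Oort1971, Lemma (2.2.4) (p. 274)] [cite: Schlessinger1968, Lemma 3.3, p. 216] -/
theorem exists_algEquiv_of_lifts [Algebra.FormallySmooth A B] [Module.Flat A B'] (hJ : IsNilpotent J)
    (ρ : B →ₐ[A] B₀) (hρ : Function.Surjective ρ) (hkρ : RingHom.ker ρ ≤ J.map (algebraMap A B))
    (ρ' : B' →ₐ[A] B₀) (hρ' : Function.Surjective ρ') (hkρ' : RingHom.ker ρ' ≤ J.map (algebraMap A B')) :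
    ∃ φ : B ≃ₐ[A] B', ∀ b, ρ' (φ b) = ρ b := by
  have hnil : IsNilpotent (RingHom.ker (ρ' : B' →+* B₀)) := isNilpotent_of_le_map hJ hkρ'
  let φ := Algebra.FormallySmooth.liftOfSurjective ρ ρ' hρ' hnil
  have hφ : ∀ b, ρ' (φ b) = ρ b := Algebra.FormallySmooth.liftOfSurjective_apply ρ ρ' hρ' hnil
  exact ⟨AlgEquiv.ofBijective φ (bijective_of_comp_eq hJ ρ hρ hkρ ρ' hkρ' φ hφ), hφ⟩

end Literature.AlgebraicGeometry.Deformation.StandardSmoothLift
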